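import Summits.HodgeConjecture.HodgeConjecture.Theorems.VHCAbelianSchemesRoadSecantQuotientAnchorCMOneAnchorJunction
import Summits.HodgeConjecture.HodgeConjecture.Theorems.VHCAbelianSchemesRoadSecantQuotientAnchorPinnedMarkman
import HarnessLib

/-!
# Road b02 (`VHCAbelianSchemesRoad`, D-0059) — lane W1 of crux `SemiregularSheafRepresentativesTwAtDiag` (item stmt-HodgeConjecture-19787):
# PRINT'S PINNED CLAIM L1″ ⟹ THE ONE-ANCHOR NODE `OneHyperbolicWeilCarrier (tw C Adm) 3 ((d+1)²·d)` (every even `d ≥ 4`), modulo a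
# hyperplane-class pin — the first kernel edge from the road's object-level preprint claim to the André ∕ Weil-ladder column (fact-free)

research route conditional on HC_CM; not a corollary; Q11.4-sentence-2 already refuted in dim ≥ 3.

THEOREMS ONLY (no definition, no new named fact; the claim-tagged L1″ `HodgeTheory.Markman2025_secantQuotient_twistedCarrier_onJacobian_pinned`
— PREPRINT arXiv:2502.03415, under review — enters as a HYPOTHESIS by name only; `HC_CM` nowhere). Sequel of `…AnchorCMOneAnchorJunction`
(p533669: 2a″ at one pinned anchor + hyperplane pin ⟹ the node). Here the stub 2a″ is replaced by the EVERY-COPY DATUM that print's pinned claim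
provides on its own anchor (b02 g88's `exists_secantQuotientDatum_pinnedClauses_of_pinned`, p513733): `κ₃ = e^*γ + c₃·(e^*h_Y(θ₀))³` on every copy
`e : X' ≅ Y_d`. Results: `SecantQuotientDatum.oneHyperbolicWeilCarrier_of_copyDatum` (door-generic); **`oneHyperbolicWeilCarrier_of_markmanPinned_of_hyperplanePin
: L1″(C, Adm) → (hyperplane pins for the pinned polarisations) → ∀ even d ≥ 4, OneHyperbolicWeilCarrier (twistedReflexiveClass C Adm) 3 ((d+1)²·d)`**;
Kodaira form `oneHyperbolicWeilCarrier_of_markmanPinned_of_kodaira` (`Kodaira1954_rationalKaehlerClass_eq_hyperplaneClass` p527661 + a Kähler real multiple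
of every pinned `h_Y(θ₀)`); twisted ∀`C` form `oneHyperbolicWeilTwistedCarrier_of_markmanPinned_of_hyperplanePin`. DOWNSTREAM (leaf file `Ring2AbelianAllOneAnchorWeilCarrierRows`,
not imported): door ∧ reach ∧ node ⟹ the Weil plane of every hyperbolic `(A, φ, h)` of dimension `6` with `φ² = −(d+1)²d` is algebraic — i.e.
«L1″ ∧ door ∧ reach ∧ hyperplane pins ⟹ Markman's Thm. 1.5.1 on the hyperbolic components of `ℚ(√−d)`, `d` even `≥ 4` (all imaginary
quadratic fields: `d = 4m`)», each input BY NAME. HONEST: the hyperplane-class pin (`∃ e a, e^*a = h_Y(θ₀)` for every datum and polarisation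
class `θ₀` of `Θ`) is a displayed hypothesis — Kodaira's embedding theorem (`Kodaira1954_rationalKaehlerClass_eq_hyperplaneClass`, p527661)
discharges it from a Kähler real multiple of `h_Y(θ₀)`, which the ample-line clause gives in print (Voisin I Thm. 7.10) but not yet as a tree
statement; nothing here says L1″, the node, the door, reach or HC holds.

References: [cite: Markman2025SecantWeil, §1.3 (p. 5), §1.5 (p. 7), Thm. 1.4.1 and Thm. 1.5.1] [cite: vanGeemen1994HodgeAV, Lemma 5.2, 5.4 and proof of Thm. 6.12]
[cite: Bloch1972Semiregularity, Remark (7.5)] [cite: Huybrechts2005, Prop. 5.3.1, Cor. 5.3.3] [cite: VoisinHodgeI2002, Thm. 7.10, Thm. 7.11].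
-/

noncomputable section

open CategoryTheory CategoryTheory.Limits AlgebraicGeometry Topology

namespace Summit.HodgeConjecture.HodgeConjecture.Ring2.SemiregularRepresentatives

set_option linter.dupNamespace false -- the cell's namespace repeats the summit name, as in every `Ring2*` file

open Literature.AlgebraicGeometry Literature.AlgebraicGeometry.Motives Literature.AlgebraicGeometry.Motives.AbelianVariety
open Literature.AlgebraicGeometry.HodgeTheory Literature.AlgebraicGeometry.Markman2025
open Literature.AlgebraicTopology.SingularHomology
open Summit.Ventures.HSemireg (ObjClass LocalVariationalHodgeFor)
open Summit.HodgeConjecture.HodgeConjecture.Ring2.AbelianAll (hyperbolicAnchorChart hyperbolicAnchorServed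
  OneHyperbolicWeilCarrier OneHyperbolicWeilTwistedCarrier)

/-! ## L1″ ⟹ the one-anchor node -/

section Markman

variable {𝒪 : ObjClass}

/-- **THE ONE-ANCHOR NODE FROM AN EVERY-COPY DATUM** (the shape of print's pinned claim L1″ read on a datum, b02 g88
`exists_secantQuotientDatum_pinnedClauses_of_pinned`): same as `oneHyperbolicWeilCarrier_of_anchoredCarrierAt_secantQuotientPinned` with the
stub 2a″ replaced by «on every copy `e : X' ≅ Y` an `𝒪`-datum with `κ₃ = e^*γ + c₃·(e^*h_Y(θ₀))³`, sides on the `e^*h_Y(θ₀)`-ray» — the node's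
charts match `θ'` with `c·h_Y(θ₀)`, `c = 2(d+1)²d`, and the side coefficients rescale by `c^{-k}`.
[cite: Markman2025SecantWeil, §1.5 (p. 7), Thm. 1.4.1 and Thm. 1.5.1] [cite: Bloch1972Semiregularity, Remark (7.5)] -/
theorem SecantQuotientDatum.oneHyperbolicWeilCarrier_of_copyDatum (D : SecantQuotientDatum)
    {θ₀ : complexBetti D.𝒥.J.X 2} {γ : complexBetti D.Y.X (2 * 3)}
    (hcopy : ∀ (X' : SchemeOver ℂ) (e : X' ≅ D.Y.X),
      ∃ (I : Finset ℕ) (κ : (k : ℕ) → complexBetti X' (2 * k)) (c : ℕ → ℂ),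
        3 ∈ I ∧ 𝒪 6 X' I κ ∧
        κ 3 = complexBetti.map e.hom (2 * 3) γ + c 3 • cupPowTwo (complexBetti.map e.hom 2 (D.hY θ₀)) 3 ∧
        ∀ k ∈ I, k ≠ 3 → κ k = c k • cupPowTwo (complexBetti.map e.hom 2 (D.hY θ₀)) k)
    (hW : IsHyperbolicWeilType D.P D.ψ 3 (complexBetti.map D.q.hom.hom.hom 2 (D.hY θ₀)))
    (hγQ : IsRationalClass γ) (hray : γ ∉ (ℂ ∙ cupPowTwo (D.hY θ₀) 3))
    (hmem : complexBetti.map D.q.hom.hom.hom (2 * 3) γ ∈ weilClassesOf D.P D.ψ 3 D.d)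
    (hea : ∃ (e : ProjectiveEmbedding D.Y.X) (a : complexBetti (projectiveSpace e.n ℂ) 2),
      IsRationalClass a ∧ a ≠ 0 ∧ complexBetti.map e.ι 2 a = D.hY θ₀) :
    OneHyperbolicWeilCarrier 𝒪 3 ((D.d + 1) ^ 2 * D.d) := by
  obtain ⟨r, hr⟩ := D.exists_q_comp_eq_nsmul_id
  have hd : 0 < D.d := by have := D.four_le; omega
  have hrq : r ≫ D.q = (D.d + 1) • 𝟙 D.Y := by
    apply D.isIsogeny_q.cancel_left
    rw [← Category.assoc, hr, Preadditive.nsmul_comp, Category.id_comp, Preadditive.comp_nsmul, Category.comp_id]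
  have hqinj : ∀ k, Function.Injective (complexBetti.map D.q.hom.hom.hom k) := fun k ↦ (D.complexBetti_map_q_bijective k).1
  have hiff : ∀ b : complexBetti D.Y.X (2 * 3), complexBetti.map D.q.hom.hom.hom (2 * 3) b ∈ weilClassesOf D.P D.ψ 3 D.d ↔
      b ∈ weilClassesOf D.Y (r ≫ D.ψ ≫ D.q) 3 ((D.d + 1) ^ 2 * D.d) := fun b ↦
    map_mem_weilClassesOf_iff_of_comp_eq_nsmul_comp D.isIsogeny_q (comp_conj_eq_nsmul_comp D.q r hr D.ψ) D.ψ_comp_ψ_nsmul hd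
      (Nat.succ_pos D.d)
  have hψθ : complexBetti.map (r ≫ D.ψ ≫ D.q).hom.hom.hom 2 (D.hY θ₀) = ((((D.d + 1) ^ 2 * D.d : ℕ)) : ℂ) • D.hY θ₀ := by
    apply hqinj 2
    have hΞ : complexBetti.map D.ψ.hom.hom.hom 2 (complexBetti.map D.q.hom.hom.hom 2 (D.hY θ₀)) =
        (D.d : ℂ) • complexBetti.map D.q.hom.hom.hom 2 (D.hY θ₀) := by
      rw [D.complexBetti_map_q_hY]
      exact complexBetti_map_weilOperator_weilPolarizationClass D.isAmple D.KTheta_eq_bot D.d θ₀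
    rw [complexBetti_map_comp₃_apply, complexBetti_map_map_of_comp_eq_nsmul_id hr, hΞ, map_smul, smul_smul]
    congr 1
    push_cast
    ring
  have hhypY : IsHyperbolicWeilType D.Y (r ≫ D.ψ ≫ D.q) 3 (D.hY θ₀) := isHyperbolicWeilType_descent (Nat.succ_ne_zero D.d) hr hqinj hW
  obtain ⟨e, a, ha, ha0, hea⟩ := hea
  set c : ℚ := ((2 * ((D.d + 1) ^ 2 * D.d) : ℕ) : ℚ) with hcdef
  have hc : c ≠ 0 := by
    have : 0 < 2 * ((D.d + 1) ^ 2 * D.d) := Nat.mul_pos two_pos (Nat.mul_pos (pow_pos (Nat.succ_pos D.d) 2) hd)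
    rw [hcdef]; exact_mod_cast this.ne'
  have hcC : (c : ℂ) ≠ 0 := by exact_mod_cast hc
  have hnode : ((((D.d + 1) ^ 2 * D.d : ℕ)) : ℂ) • complexBetti.map e.ι 2 a +
      complexBetti.map (r ≫ D.ψ ≫ D.q).hom.hom.hom 2 (complexBetti.map e.ι 2 a) = (c : ℂ) • D.hY θ₀ := by
    rw [hea, hψθ, ← add_smul, hcdef]
    congr 1
    push_cast
    ring
  refine ⟨D.Y, r ≫ D.ψ ≫ D.q, e, a, γ, D.dim_Y, conj_comp_conj D.q r hr hrq D.ψ_comp_ψ_nsmul, ha, ha0, ?_, (hiff γ).1 hmem, hγQ,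
    ?_, ?_⟩
  · rw [hnode]
    exact (isHyperbolicWeilType_smul_iff hcC).2 hhypY
  · intro h0
    exact hray (by rw [h0]; exact Submodule.zero_mem _)
  · rw [hnode]
    intro X θ' _ w' hw' hw'Q
    obtain ⟨e'', he''θ, he''w⟩ := hw'
    -- the datum on the copy `e''.symm : X ≅ Y`
    obtain ⟨I, κ, c₀, h3, h𝒪, hκ3, hκk⟩ := hcopy X e''.symm
    have hθ' : complexBetti.map e''.symm.hom 2 (D.hY θ₀) = ((c : ℂ))⁻¹ • θ' := by
      have h1 : D.hY θ₀ = ((c : ℂ))⁻¹ • complexBetti.map e''.hom 2 θ' := by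
        rw [he''θ, smul_smul, inv_mul_cancel₀ hcC, one_smul]
      rw [h1, map_smul, Iso.symm_hom, Iso.complexBetti_map_inv_map_hom]
    have hw'eq : complexBetti.map e''.symm.hom (2 * 3) γ = w' := by
      rw [← he''w, Iso.symm_hom, Iso.complexBetti_map_inv_map_hom]
    refine ⟨I, κ, 1, fun k ↦ c₀ k * ((c : ℂ))⁻¹ ^ k, h3, h𝒪, one_ne_zero, ?_, fun k hk hk3 ↦ ?_⟩
    · rw [hκ3, hw'eq, hθ', cupPowTwo_smul, smul_smul, one_smul]
    · rw [hκk k hk hk3, hθ', cupPowTwo_smul, smul_smul]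

/-- **PRINT'S PINNED CLAIM L1″ ⟹ THE ONE-ANCHOR NODE**, per `C` and `Adm`, granted a hyperplane-class pin for every pinned polarisation
`h_Y(θ₀)` of every secant–quotient datum (Kodaira's theorem for these ample-line classes): for every even `d ≥ 4`,
`Markman2025_secantQuotient_twistedCarrier_onJacobian_pinned C Adm ⟹ OneHyperbolicWeilCarrier (twistedReflexiveClass C Adm) 3 ((d+1)²·d)`
(b02 g88's `exists_secantQuotientDatum_pinnedClauses_of_pinned` read on a datum, then the previous theorem). The first kernel edge from the
road's object-level PREPRINT claim to the André ∕ Weil-ladder column's smallest node; with door ∧ reach the Rows file turns the node into the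
algebraicity of the Weil plane of every hyperbolic `(A, φ, h)` of dimension `6` with `φ² = −(d+1)²d`. Nothing here says L1″, the node, the door
or Kodaira's theorem holds. [cite: Markman2025SecantWeil, Thm. 1.4.1, §1.5 and Thm. 1.5.1] [cite: vanGeemen1994HodgeAV, proof of Thm. 6.12]
[cite: Huybrechts2005, Prop. 5.3.1, Cor. 5.3.3] -/
theorem oneHyperbolicWeilCarrier_of_markmanPinned_of_hyperplanePin {C : ChernCharacterBetti} {Adm : PerfectAdmissibility}
    (hM : Markman2025_secantQuotient_twistedCarrier_onJacobian_pinned C Adm)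
    (hpin : ∀ (D : SecantQuotientDatum) (θ₀ : complexBetti D.𝒥.J.X 2), D.𝒥.J.IsPolarizationClassOf D.Θ θ₀ →
      IsPolarizationClass 6 D.Y.X (D.hY θ₀) →
      ∃ (e : ProjectiveEmbedding D.Y.X) (a : complexBetti (projectiveSpace e.n ℂ) 2),
        IsRationalClass a ∧ a ≠ 0 ∧ complexBetti.map e.ι 2 a = D.hY θ₀)
    {d : ℕ} (hd : Even d) (h4 : 4 ≤ d) :
    OneHyperbolicWeilCarrier (twistedReflexiveClass C Adm) 3 ((d + 1) ^ 2 * d) := by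
  obtain ⟨D, θ₀, γ, rfl, hθ₀, hpol, -, hW, hγQ, hray, hmem, hcopy⟩ := exists_secantQuotientDatum_pinnedClauses_of_pinned hM hd h4
  exact D.oneHyperbolicWeilCarrier_of_copyDatum hcopy hW hγQ hray hmem (hpin D θ₀ hθ₀ hpol)

/-- **Kodaira form**: with `Kodaira1954_rationalKaehlerClass_eq_hyperplaneClass` (p527661) BY NAME, the hyperplane pins exist as soon as every
pinned polarisation `h_Y(θ₀)` has a Kähler real multiple (the content of its ample-line clause — Voisin I Thm. 7.10 — displayed, not yet a tree
statement): L1″ ⟹ the one-anchor node at `(3, (d+1)²d)` for every even `d ≥ 4`. [cite: Huybrechts2005, Prop. 5.3.1, Cor. 5.3.3]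
[cite: VoisinHodgeI2002, Thm. 7.10, Thm. 7.11] [cite: Markman2025SecantWeil, Thm. 1.4.1 and §1.5] -/
theorem oneHyperbolicWeilCarrier_of_markmanPinned_of_kodaira {C : ChernCharacterBetti} {Adm : PerfectAdmissibility}
    (hM : Markman2025_secantQuotient_twistedCarrier_onJacobian_pinned C Adm) (hK : Kodaira1954_rationalKaehlerClass_eq_hyperplaneClass)
    (hKm : ∀ (D : SecantQuotientDatum) (θ₀ : complexBetti D.𝒥.J.X 2), D.𝒥.J.IsPolarizationClassOf D.Θ θ₀ →
      ∃ s : ℝ, s ≠ 0 ∧ IsKaehlerClass 6 D.Y.X ((s : ℂ) • D.hY θ₀))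
    {d : ℕ} (hd : Even d) (h4 : 4 ≤ d) :
    OneHyperbolicWeilCarrier (twistedReflexiveClass C Adm) 3 ((d + 1) ^ 2 * d) := by
  refine oneHyperbolicWeilCarrier_of_markmanPinned_of_hyperplanePin hM (fun D θ₀ hθ₀ hpol ↦ ?_) hd h4
  have hX : IsSmoothProjective 6 D.Y.X := D.dim_Y ▸ AbelianVariety.isSmoothProjective_holds (A := D.Y)
  obtain ⟨e, a, ha, ha0, hea⟩ := hK hX (by norm_num) (D.hY θ₀) hpol.isRationalClass (hKm D θ₀ hθ₀)
  exact ⟨e, a, ha, ha0, hea⟩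

/-- **Twisted door, every `C`: `(∀ C, L1″ C AdmTw)` ∧ hyperplane pins ⟹ `OneHyperbolicWeilTwistedCarrier 3 ((d+1)²·d)`** for every even
`d ≥ 4`. [cite: Markman2025SecantWeil, Thm. 1.4.1, §1.5 and §7.3] [cite: Bloch1972Semiregularity, Remark (7.5)] -/
theorem oneHyperbolicWeilTwistedCarrier_of_markmanPinned_of_hyperplanePin
    (hM : ∀ C : ChernCharacterBetti, Markman2025_secantQuotient_twistedCarrier_onJacobian_pinned C
      (fun n X₀ I E => Summit.Ventures.HSemireg.gluableSigmaAdmissible n X₀ I E ∨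
        Literature.AlgebraicGeometry.HodgeTheory.bfSingleAdmissible n X₀ I E))
    (hpin : ∀ (D : SecantQuotientDatum) (θ₀ : complexBetti D.𝒥.J.X 2), D.𝒥.J.IsPolarizationClassOf D.Θ θ₀ →
      IsPolarizationClass 6 D.Y.X (D.hY θ₀) →
      ∃ (e : ProjectiveEmbedding D.Y.X) (a : complexBetti (projectiveSpace e.n ℂ) 2),
        IsRationalClass a ∧ a ≠ 0 ∧ complexBetti.map e.ι 2 a = D.hY θ₀)
    {d : ℕ} (hd : Even d) (h4 : 4 ≤ d) :
    OneHyperbolicWeilTwistedCarrier 3 ((d + 1) ^ 2 * d) :=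
  fun C ↦ oneHyperbolicWeilCarrier_of_markmanPinned_of_hyperplanePin (hM C) hpin hd h4

end Markman

end Summit.HodgeConjecture.HodgeConjecture.Ring2.SemiregularRepresentatives

end
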